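import Literature.GroupTheory.CombinatorialGroupTheory.PuncturedSurfaceGroupUnrQuotientCoprod
import Literature.GroupTheory.CombinatorialGroupTheory.PuncturedSurfaceGroupTwoComponentBases
import Literature.GroupTheory.CombinatorialGroupTheory.PuncturedSurfaceGroupCusps
import HarnessLib

/-!
# The closed component of a two-component curve: `Γ_{g₁,1} ↪ Γ_{g₀+g₁,r}` with the cusp sent to the node loop

Topic `Literature/GroupTheory/CombinatorialGroupTheory`; theorems only.  For the degeneration of a smooth
curve of type `(g₀ + g₁, r)`, `r ≥ 1`, to a pointed component `C₀` (handles `i < g₀`, all the cusps) glued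
at ONE node to a CLOSED component `C₁` (handles `i ≥ g₀`): the fundamental group of `C₁` minus the node is
the once-punctured surface group `Γ_{g₁,1}`, embedded in `Γ_{g₀+g₁,r}` by `a_j ↦ a_{g₀+j}`, `b_j ↦ b_{g₀+j}`
and `c₀ ↦ ε = (∏_{i ≥ g₀}[a_i,b_i])⁻¹` (the node loop; `nodeLoop_rel` with `s = 0`), injective (the
retraction killing the letters of `C₀` is a left inverse) and with image the subgroup generated by the
handles of `C₁` ([SemiAnbd] Example 2.10 p. 31: the vertex groups of the dual semi-graph of a pointed
stable curve are the fundamental groups of the punctured irreducible components)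
[cite: MochizukiSemiAnbd2006, Ex. 2.10 p.31].  Consumer: the boundary-node separating coverings of [CombGC]
Prop. 1.2, proof p. 9, at two-component data with `C₁` unmarked (abc-iut-f-164).

* `exists_hom_closedComponent` — the embedding `θ`, its values, injectivity and range.
Elementary; 0 definitions; nothing here concerns [IUTchIII].
-/

namespace Literature.GroupTheory.CombinatorialGroupTheory.PuncturedSurfaceGroup

variable {g₀ g₁ r' : ℕ}

/-- **`Γ_{g₁,1} ↪ Γ_{g₀+g₁,r'+1}`, `c₀ ↦ ε`.**  For `ε = (c_0⋯c_{r'}) ∏_{i<g₀}[a_i,b_i]` (the node loop of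
the two-component degeneration with `C₁` unmarked, `s = 0`): an injective homomorphism `θ` with
`θ(a_j) = a_{g₀+j}`, `θ(b_j) = b_{g₀+j}`, `θ(c₀) = ε`, whose range is the subgroup generated by the handles
`a_i, b_i`, `i ≥ g₀` (which contains `ε`). [cite: MochizukiSemiAnbd2006, Ex. 2.10 p.31] -/
theorem exists_hom_closedComponent (ε : PuncturedSurfaceGroup (g₀ + g₁) (r' + 1))
    (hε : ε = ((List.finRange (r' + 1)).map fun j : Fin (r' + 1) =>
        if 0 ≤ (j : ℕ) then c (g := g₀ + g₁) j else 1).prod *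
      ((List.finRange (g₀ + g₁)).map fun i : Fin (g₀ + g₁) => if (i : ℕ) < g₀ then
        a (r := r' + 1) i * b i * (a i)⁻¹ * (b i)⁻¹ else 1).prod) :
    ∃ θ : PuncturedSurfaceGroup g₁ 1 →* PuncturedSurfaceGroup (g₀ + g₁) (r' + 1),
      Function.Injective θ ∧ (∀ j, θ (a j) = a (Fin.natAdd g₀ j)) ∧ (∀ j, θ (b j) = b (Fin.natAdd g₀ j)) ∧
      θ (c 0) = ε ∧
      θ.range = Subgroup.closure {x : PuncturedSurfaceGroup (g₀ + g₁) (r' + 1) |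
        ∃ i : Fin (g₀ + g₁), g₀ ≤ (i : ℕ) ∧ (x = a i ∨ x = b i)} := by
  classical
  -- the handle product of `C₁`: `Y = ∏_{i ≥ g₀}[a_i,b_i] = ∏_j [a_{g₀+j}, b_{g₀+j}]`, and `Y ε = 1`
  set Y : PuncturedSurfaceGroup (g₀ + g₁) (r' + 1) := ((List.finRange (g₀ + g₁)).map
    fun i : Fin (g₀ + g₁) => if g₀ ≤ (i : ℕ) then a (r := r' + 1) i * b i * (a i)⁻¹ * (b i)⁻¹ else 1).prod
    with hY
  have hYε : Y * ε = 1 := by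
    have h := nodeLoop_rel (g := g₀ + g₁) (r := r' + 1) g₀ 0 ε hε
    have hC : ((List.finRange (r' + 1)).map fun j : Fin (r' + 1) =>
        if (j : ℕ) < 0 then c (g := g₀ + g₁) j else 1).prod = 1 :=
      List.prod_eq_one fun y hy => by
        obtain ⟨j, -, rfl⟩ := List.mem_map.mp hy
        exact if_neg (Nat.not_lt_zero _)
    rw [hC, mul_one] at h
    exact h
  have hY' : Y = ((List.finRange g₁).map fun j : Fin g₁ =>
      a (r := r' + 1) (Fin.natAdd g₀ j) * b (Fin.natAdd g₀ j) * (a (Fin.natAdd g₀ j))⁻¹ *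
        (b (Fin.natAdd g₀ j))⁻¹).prod := by
    rw [hY, prod_map_finRange_add]
    have h1 : ((List.finRange g₀).map fun i : Fin g₀ =>
        (fun i : Fin (g₀ + g₁) => if g₀ ≤ (i : ℕ) then a (r := r' + 1) i * b i * (a i)⁻¹ * (b i)⁻¹ else 1)
          (Fin.castAdd g₁ i)).prod = 1 :=
      List.prod_eq_one fun y hy => by
        obtain ⟨i, -, rfl⟩ := List.mem_map.mp hy
        simp
    rw [h1, one_mul]
    congr 1
    refine List.map_congr_left fun j _ => ?_
    simp
  -- the homomorphism
  let F : puncturedSurfaceGen g₁ 1 → PuncturedSurfaceGroup (g₀ + g₁) (r' + 1) :=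
    Sum.elim (fun jb => if jb.2 then b (Fin.natAdd g₀ jb.1) else a (Fin.natAdd g₀ jb.1)) fun _ => ε
  have hFa : ∀ j, F (Sum.inl (j, false)) = a (Fin.natAdd g₀ j) := fun j => by simp [F]
  have hFb : ∀ j, F (Sum.inl (j, true)) = b (Fin.natAdd g₀ j) := fun j => by simp [F]
  have hrel : ∀ w ∈ ({relator g₁ 1} : Set (FreeGroup (puncturedSurfaceGen g₁ 1))), FreeGroup.lift F w = 1 := by
    intro w hw
    rw [Set.mem_singleton_iff] at hw
    rw [hw, lift_relator]
    have h1 : ((List.finRange g₁).map fun j =>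
        F (Sum.inl (j, false)) * F (Sum.inl (j, true)) * (F (Sum.inl (j, false)))⁻¹ *
          (F (Sum.inl (j, true)))⁻¹).prod = Y := by
      rw [hY']
      congr 1
    have h2 : ((List.finRange 1).map fun j => F (Sum.inr j)).prod = ε := by
      simp [F, List.finRange_succ]
    rw [h1, h2, hYε]
  let θ : PuncturedSurfaceGroup g₁ 1 →* PuncturedSurfaceGroup (g₀ + g₁) (r' + 1) := PresentedGroup.toGroup hrel
  have hθa : ∀ j, θ (a j) = a (Fin.natAdd g₀ j) := fun j => by
    change PresentedGroup.toGroup hrel (PresentedGroup.of _) = _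
    rw [PresentedGroup.toGroup.of, hFa]
  have hθb : ∀ j, θ (b j) = b (Fin.natAdd g₀ j) := fun j => by
    change PresentedGroup.toGroup hrel (PresentedGroup.of _) = _
    rw [PresentedGroup.toGroup.of, hFb]
  have hθc : θ (c 0) = ε := by
    change PresentedGroup.toGroup hrel (PresentedGroup.of _) = _
    rw [PresentedGroup.toGroup.of]
    rfl
  -- the retraction killing the letters of `C₀` (a left inverse)
  obtain ⟨b₀, ha, hb, hc⟩ := exists_freeGroupBasis_elim_zero (g₀ + g₁) r'
  let R : (Fin (g₀ + g₁) × Bool) ⊕ Fin r' → PuncturedSurfaceGroup g₁ 1 :=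
    Sum.elim (fun ib => Fin.addCases (motive := fun _ => Bool → PuncturedSurfaceGroup g₁ 1)
      (fun _ _ => 1) (fun j bit => if bit then b j else a j) ib.1 ib.2) fun _ => 1
  have hRleft : ∀ (i : Fin g₀) (bit : Bool), R (Sum.inl (Fin.castAdd g₁ i, bit)) = 1 := fun i bit => by
    simp only [R, Sum.elim_inl, Fin.addCases_left]
  have hRright : ∀ (j : Fin g₁) (bit : Bool),
      R (Sum.inl (Fin.natAdd g₀ j, bit)) = if bit then b j else a j := fun j bit => by
    simp only [R, Sum.elim_inl, Fin.addCases_right]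
  let π : PuncturedSurfaceGroup (g₀ + g₁) (r' + 1) →* PuncturedSurfaceGroup g₁ 1 := b₀.lift R
  have hπb₀ : ∀ x, π (b₀ x) = R x := fun x => by
    change FreeGroup.lift R (b₀.repr (b₀ x)) = R x
    rw [FreeGroupBasis.repr_apply_coe, FreeGroup.lift_apply_of]
  have hπa : ∀ j, π (a (Fin.natAdd g₀ j)) = a j := fun j => by rw [← ha, hπb₀, hRright]; rfl
  have hπb : ∀ j, π (b (Fin.natAdd g₀ j)) = b j := fun j => by rw [← hb, hπb₀, hRright]; rfl
  have hπY : π Y = ((List.finRange g₁).map fun j : Fin g₁ => a (r := 1) j * b j * (a j)⁻¹ * (b j)⁻¹).prod := by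
    rw [hY', map_list_prod, List.map_map]
    congr 1
    refine List.map_congr_left fun j _ => ?_
    simp only [Function.comp_apply, map_mul, map_inv, hπa, hπb]
  have hπε : π ε = c 0 := by
    have h1 : π ε = (π Y)⁻¹ := by
      rw [eq_inv_of_mul_eq_one_right hYε, map_inv]
    have h2 := comm_prod_mul_cusp_prod_eq_one (g := g₁) (r := 1)
    have h3 : ((List.finRange 1).map fun j : Fin 1 => c (g := g₁) j).prod = c 0 := by
      simp [List.finRange_succ]
    rw [h3] at h2
    rw [h1, hπY]
    exact (eq_inv_of_mul_eq_one_right h2).symm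
  have hπθ : π.comp θ = MonoidHom.id _ := by
    refine PresentedGroup.ext fun x => ?_
    rcases x with ⟨j, _ | _⟩ | j
    · change π (θ (a j)) = a j
      rw [hθa, hπa]
    · change π (θ (b j)) = b j
      rw [hθb, hπb]
    · have hj : j = 0 := Fin.eq_zero j
      subst hj
      change π (θ (c 0)) = c 0
      rw [hθc, hπε]
  have hinj : Function.Injective θ := by
    refine Function.LeftInverse.injective (g := π) fun x => ?_
    change (π.comp θ) x = x
    rw [hπθ, MonoidHom.id_apply]
  -- the range
  have hεmem : ε ∈ Subgroup.closure {x : PuncturedSurfaceGroup (g₀ + g₁) (r' + 1) |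
      ∃ i : Fin (g₀ + g₁), g₀ ≤ (i : ℕ) ∧ (x = a i ∨ x = b i)} := by
    have : ε = Y⁻¹ := eq_inv_of_mul_eq_one_right hYε
    rw [this]
    refine Subgroup.inv_mem _ (comm_prod_ite_mem _ _ (fun i hi => ?_) (fun i hi => ?_))
    · exact Subgroup.subset_closure ⟨i, hi, Or.inl rfl⟩
    · exact Subgroup.subset_closure ⟨i, hi, Or.inr rfl⟩
  have hrange : θ.range = Subgroup.closure {x : PuncturedSurfaceGroup (g₀ + g₁) (r' + 1) |
      ∃ i : Fin (g₀ + g₁), g₀ ≤ (i : ℕ) ∧ (x = a i ∨ x = b i)} := by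
    apply le_antisymm
    · rw [MonoidHom.range_eq_map, ← PresentedGroup.closure_range_of, MonoidHom.map_closure,
        Subgroup.closure_le]
      rintro _ ⟨_, ⟨x, rfl⟩, rfl⟩
      rcases x with ⟨j, _ | _⟩ | j
      · change θ (a j) ∈ _
        rw [hθa]
        exact Subgroup.subset_closure ⟨_, by simp, Or.inl rfl⟩
      · change θ (b j) ∈ _
        rw [hθb]
        exact Subgroup.subset_closure ⟨_, by simp, Or.inr rfl⟩
      · have hj : j = 0 := Fin.eq_zero j
        subst hj
        change θ (c 0) ∈ _
        rw [hθc]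
        exact hεmem
    · rw [Subgroup.closure_le]
      rintro x ⟨i, hi, rfl | rfl⟩
      · have ei : Fin.natAdd g₀ ⟨(i : ℕ) - g₀, by omega⟩ = i := Fin.ext (by simp; omega)
        exact ⟨a ⟨(i : ℕ) - g₀, by omega⟩, by rw [hθa, ei]⟩
      · have ei : Fin.natAdd g₀ ⟨(i : ℕ) - g₀, by omega⟩ = i := Fin.ext (by simp; omega)
        exact ⟨b ⟨(i : ℕ) - g₀, by omega⟩, by rw [hθb, ei]⟩
  exact ⟨θ, hinj, hθa, hθb, hθc, hrange⟩

end Literature.GroupTheory.CombinatorialGroupTheory.PuncturedSurfaceGroup
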